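/-
Copyright (c) 2026 the pub-hodgecm-mathlib formalisation cell (harness21).  Prover seat hodgecm-mathlib-K2Liu-p06 (g3): Track B «K2-LIT»,
hLiu418 = stmt-HodgeConjecture-24832; Φ7-groundwork offered 2026-09-04 (REPORT-FIRST K2Liu-p06 (g3), silence = GO); 2026-09-04.
-/
import Summits.HodgeConjecture.HodgeConjecture.Theorems.K2LiuSiegelEisensteinCoeffNondegenerate   -- ★ Φ2 assembly (files 1–8) + ★ B2c
import HarnessLib

/-!
# Crux `HLiu418`, ROAD Φ, organ Φ2∕Φ7 bridge: THE SURVIVOR CRITERION FOR MIDDLE ORBITS — the `N_Δ(L⁺)`-orbit of `[w_χ p']` contributes to the `S`-th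
# Fourier coefficient of the Siegel Eisenstein series ONLY IF the conjugated index `S^{p'} = D₀ S A₀⁻¹` lives on the corner `χ × χ`, and this is sharp

Cell `hodgecm-mathlib`, crux item hLiu418 = `stmt-HodgeConjecture-24832`, route `HCCMUnconditional`; squad K2 ∕ K2Liu, LEAD F0P6-plan (g12), dealer K2E5-plan (g6),
prover K2Liu-p06 (g3).  THEOREMS ONLY (imports ★ Φ2 assembly); lane `--supports stmt-HodgeConjecture-24832 --as helper` (count-neutral).

WHAT (any `n`, any `T_L`-skew index `S`, degenerate allowed).  For a middle representative `γ₀ = w_χ p'` (`w_χ = ι(1, diag(1 − 2χ∘e) ⊗ 1)`, `p' ∈ P_Δ(L⁺)`) write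
`E = diag(χ ⊗ 1)` and `S^{p'}_𝔸 := D'_𝔸 · S_𝔸 · (A'_𝔸)⁻¹` with `A'_𝔸 = p'|_Δ` (★ `deltaBlock`), `D'_𝔸` the co-block of the frame of `p'` — the conjugated index of ★ Φ2 file 6
(`ψ_S(p'⁻¹ u p') = ψ_{S^{p'}}(u)`).
* §1 `stabilizer_iff_corner`: for `s₀ ∈ N_Δ(𝔸)`, `γ₀ s₀ γ₀⁻¹ ∈ P_Δ(𝔸) ⟺ E · X(p' s₀ p'⁻¹) · E = 0` (★ B2b `isSiegelDelta_conj_unip_iff`): the stabiliser of the orbit is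
  `p'⁻¹ N_E p'`, `N_E` the corner group.  `unipDeltaChar_conj_eq_one_of_corner`: if `S^{p'}_𝔸 = E S^{p'}_𝔸 E` then `ψ_S ≡ 1` on that stabiliser.
* §2 **`exists_orbit_stabilizer_datum_of_ne_corner`**: if `S^{p'}_𝔸 ≠ E S^{p'}_𝔸 E` there is a killing datum `s₀` (`γ₀ s₀ γ₀⁻¹ ∈ P_Δ`, trivial inducing character,
  `ψ_S(s₀) ≠ 1`) — ★ Φ2 file 5 `map_eq_corner_of_forall_unipDeltaChar_eq_one` in place of the `det S ≠ 0` test of ★ file 7; hence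
  **`tsum_middle_orbit_eq_zero_of_ne_corner`**: the orbit sum of `J_S(q) = ∫ β conj ψ_S f(γ_q u h)` over `O(w_χ p')` VANISHES.
* §3 SHARPNESS **`forall_stabilizer_unipDeltaChar_eq_one_iff_corner`**: «no killing datum» ⟺ `S^{p'}_𝔸 = E S^{p'}_𝔸 E`.  So the middle orbits that survive in
  `E_S` are exactly those with corner-supported conjugated index — for `det S ≠ 0` none (★ `integral_rest_eq_zero`), for `rank S = r < n` the orbits carrying the
  rank-`r` singular coefficient (Φ7's «MID ↔ lower-rank series» starts here).  The `MID_S`-level corollaries (abstract orbit vanishing ⇒ `MID_S = 0`;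
  the corner form recovering ★ `integral_rest_eq_zero`) are the sequel `K2LiuSiegelEisensteinCoeffRestOrbits` (400-line law).
[KudlaRallis1994, §2], [Shimura1997, §18.3], [Tan1999, §3], [MoeglinWaldspurger1995, II.1.7].

HONEST LABEL.  Count-neutral helper; `HC_CM` is proved only modulo the 7 printed citations (2 remaining named inputs: hLiu418 = `stmt-HodgeConjecture-24832`,
h413 = `stmt-HodgeConjecture-24833`) until rung 0 closes.
-/

set_option autoImplicit false
set_option linter.dupNamespace false -- the mandated namespace repeats `HodgeConjecture.HodgeConjecture`

noncomputable section

open scoped Matrix ENNReal NNReal ComplexConjugate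
open NumberField IsDedekindDomain MeasureTheory MeasureTheory.Measure Filter Set Function
open Literature.NumberTheory.Automorphic Literature.NumberTheory.Automorphic.UnitaryGroup Literature.NumberTheory.GaloisRepresentations
open Literature.NumberTheory.GelbartRogawski1991 Literature.NumberTheory.GelbartRogawski1991.GRConstruction
open Literature.NumberTheory.K2Lit.SiegelDoubled Literature.MeasureTheory.Group
open UnitaryDualPair

namespace Summit.HodgeConjecture.HodgeConjecture.Cruxes.HLiu418.K2LiuSiegelEisensteinCoeffOrbitCriterion

open K2LiuUnipotentCoveringWeight K2LiuConstantTermBigCellUnfold K2LiuSiegelDoubledUnfold K2LiuSiegelUnipotentFourierDefs K2LiuSiegelUnipotentCharacters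
  K2LiuSiegelEisensteinCoeffCells K2LiuSiegelEisensteinCoeffOrbitSum K2LiuSiegelBruhatMiddleCellDelta
  K2LiuSiegelMiddleStabilizerCharacter K2LiuSiegelMiddleStabilizerNontrivial K2LiuSiegelLeviConjUnipDeltaChar K2LiuSiegelBruhatMiddleCellExhaustion
  K2LiuSiegelEisensteinCoeffMiddleOrbits K2LiuSiegelDoubledRationalPoints

variable {L : Type} [Field L] [NumberField L] [IsCMField L]
variable {N M n : ℕ} {e : Fin N × Fin M ≃ Fin n}
  {dV : Fin N → L} {hdV : ∀ i, IsCMField.complexConj L (dV i) = dV i}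
  {dW : Fin M → L} {hdW : ∀ i, IsCMField.complexConj L (dW i) = dW i}

/-! ## §1 The stabiliser of a middle orbit is the conjugated corner group -/

/-- **`γ₀ s₀ γ₀⁻¹ ∈ P_Δ ⟺ E · X(p' s₀ p'⁻¹) · E = 0`** for `γ₀ = w_χ p'`, `s₀ ∈ N_Δ(𝔸)` (★ B2b `isSiegelDelta_conj_unip_iff`, `(1 − G) = 2E`, `4 ∈ 𝔸ˣ`).
[cite: MoeglinWaldspurger1995, II.1.7] [cite: GelbartPiatetskishapiroRallis1987, Part A §§1–2] -/
theorem stabilizer_iff_corner {g : UnitaryGroup.rationalPair (Fp L) L (IsCMField.complexConj L) N M (Matrix.diagonal dV) (Matrix.diagonal dW)} {χ : Fin n → L}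
    (hg : ((g : GL (Fin N × Fin M) L) : Matrix (Fin N × Fin M) (Fin N × Fin M) L) = Matrix.diagonal (fun k => 1 - 2 * χ (e k))) (hgg : g * g = 1)
    {p' : HA L e dV hdV dW hdW} (hp'P : IsSiegelDelta L e dV hdV dW hdW p') {s₀ : HA L e dV hdV dW hdW} (hs₀ : s₀ ∈ unipDelta L e dV hdV dW hdW) :
    IsSiegelDelta L e dV hdV dW hdW (iotaGG L e dV hdV dW hdW
          (1, UnitaryGroup.rationalPairToAdelic (Fp L) L (IsCMField.complexConj L) N M (Matrix.diagonal dV) (Matrix.diagonal dW) g) * p' * s₀ *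
        (iotaGG L e dV hdV dW hdW (1, UnitaryGroup.rationalPairToAdelic (Fp L) L (IsCMField.complexConj L) N M (Matrix.diagonal dV) (Matrix.diagonal dW) g) * p')⁻¹) ↔
      Matrix.diagonal (fun i => algebraMap L (AdeleRing (𝓞 L) L) (χ i)) * (blk L e dV hdV dW hdW (p' * s₀ * p'⁻¹)).toBlocks₁₂ *
        Matrix.diagonal (fun i => algebraMap L (AdeleRing (𝓞 L) L) (χ i)) = 0 := by
  have hgg' : UnitaryGroup.rationalPairToAdelic (Fp L) L (IsCMField.complexConj L) N M (Matrix.diagonal dV) (Matrix.diagonal dW) g *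
      UnitaryGroup.rationalPairToAdelic (Fp L) L (IsCMField.complexConj L) N M (Matrix.diagonal dV) (Matrix.diagonal dW) g = 1 := by
    rw [← map_mul, hgg, map_one]
  have hu : p' * s₀ * p'⁻¹ ∈ unipDelta L e dV hdV dW hdW := by
    have h := conj_mem_unipDelta L e dV hdV dW hdW (isSiegelDelta_inv L e dV hdV dW hdW hp'P) hs₀
    rwa [inv_inv] at h
  have hwinv : (iotaGG L e dV hdV dW hdW (1, UnitaryGroup.rationalPairToAdelic (Fp L) L (IsCMField.complexConj L) N M (Matrix.diagonal dV) (Matrix.diagonal dW) g))⁻¹ =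
      iotaGG L e dV hdV dW hdW (1, UnitaryGroup.rationalPairToAdelic (Fp L) L (IsCMField.complexConj L) N M (Matrix.diagonal dV) (Matrix.diagonal dW) g) :=
    inv_eq_of_mul_eq_one_right (iotaGG_one_mul_self L e dV hdV dW hdW hgg')
  have hconj : iotaGG L e dV hdV dW hdW (1, UnitaryGroup.rationalPairToAdelic (Fp L) L (IsCMField.complexConj L) N M (Matrix.diagonal dV) (Matrix.diagonal dW) g) * p' * s₀ *
        (iotaGG L e dV hdV dW hdW (1, UnitaryGroup.rationalPairToAdelic (Fp L) L (IsCMField.complexConj L) N M (Matrix.diagonal dV) (Matrix.diagonal dW) g) * p')⁻¹ =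
      iotaGG L e dV hdV dW hdW (1, UnitaryGroup.rationalPairToAdelic (Fp L) L (IsCMField.complexConj L) N M (Matrix.diagonal dV) (Matrix.diagonal dW) g) * (p' * s₀ * p'⁻¹) *
        iotaGG L e dV hdV dW hdW (1, UnitaryGroup.rationalPairToAdelic (Fp L) L (IsCMField.complexConj L) N M (Matrix.diagonal dV) (Matrix.diagonal dW) g) := by
    rw [mul_inv_rev, hwinv]; simp only [mul_assoc]
  rw [hconj, isSiegelDelta_conj_unip_iff L e dV hdV dW hdW hgg' hu, one_sub_reindex_signInvolution L e dV dW hg]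
  simp only [Matrix.smul_mul, Matrix.mul_smul, smul_smul]
  constructor
  · intro h
    have h4 : (⅟ (2 : AdeleRing (𝓞 L) L) * ⅟ (2 : AdeleRing (𝓞 L) L)) • (((2 : AdeleRing (𝓞 L) L) * 2) •
        (Matrix.diagonal (fun i => algebraMap L (AdeleRing (𝓞 L) L) (χ i)) * (blk L e dV hdV dW hdW (p' * s₀ * p'⁻¹)).toBlocks₁₂ *
          Matrix.diagonal (fun i => algebraMap L (AdeleRing (𝓞 L) L) (χ i)))) = 0 := by rw [h, smul_zero]
    rwa [smul_smul, show (⅟ (2 : AdeleRing (𝓞 L) L) * ⅟ (2 : AdeleRing (𝓞 L) L)) * ((2 : AdeleRing (𝓞 L) L) * 2) = 1 by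
      rw [mul_assoc, ← mul_assoc (⅟ (2 : AdeleRing (𝓞 L) L)) 2 2, invOf_mul_self, one_mul, invOf_mul_self], one_smul] at h4
  · intro h
    rw [h, smul_zero]

/-- the conjugated index in adelic coordinates: `ψ_S(p'⁻¹ u p') = ψ_L(tr(S^{p'}_𝔸 · X(u)))`, `S^{p'}_𝔸 = D'_𝔸 S_𝔸 (A'_𝔸)⁻¹` (★ Φ2 file 6 `deltaBlock_mul_toBlocks₁₂_conj`).
[cite: Shimura1997, §18.1] [cite: MoeglinWaldspurger1995, II.1.7] -/
theorem unipDeltaChar_conj_apply {p' : HA L e dV hdV dW hdW} (hp'P : IsSiegelDelta L e dV hdV dW hdW p') (S : Matrix (Fin n) (Fin n) L)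
    {u : HA L e dV hdV dW hdW} (hu : u ∈ unipDelta L e dV hdV dW hdW) :
    unipDeltaChar L e dV hdV dW hdW S (p'⁻¹ * u * p') =
      adeleAddChar L (Matrix.trace
        ((Matrix.fromBlocks (1 : Matrix (Fin n) (Fin n) (AdeleRing (𝓞 L) L)) 0 (-1) 1 * blk L e dV hdV dW hdW p' * Matrix.fromBlocks 1 0 1 1).toBlocks₂₂ *
            S.map (algebraMap L (AdeleRing (𝓞 L) L)) * (deltaBlock L e dV hdV dW hdW p')⁻¹ *
          (blk L e dV hdV dW hdW u).toBlocks₁₂)) := by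
  have hA : IsUnit (deltaBlock L e dV hdV dW hdW p').det := isUnit_detDelta_of_isSiegelDelta L e dV hdV dW hdW p' hp'P
  have hX : (blk L e dV hdV dW hdW (p'⁻¹ * u * p')).toBlocks₁₂ =
      (deltaBlock L e dV hdV dW hdW p')⁻¹ * ((blk L e dV hdV dW hdW u).toBlocks₁₂ *
        (Matrix.fromBlocks (1 : Matrix (Fin n) (Fin n) (AdeleRing (𝓞 L) L)) 0 (-1) 1 * blk L e dV hdV dW hdW p' * Matrix.fromBlocks 1 0 1 1).toBlocks₂₂) := by
    rw [← deltaBlock_mul_toBlocks₁₂_conj L e dV hdV dW hdW hp'P hu, Matrix.nonsing_inv_mul_cancel_left _ _ hA]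
  rw [unipDeltaChar_apply, hX, ← Matrix.mul_assoc, ← Matrix.mul_assoc, Matrix.trace_mul_comm, ← Matrix.mul_assoc, ← Matrix.mul_assoc]

/-- **a corner-supported conjugated index is invisible to the stabiliser**: if `S^{p'}_𝔸 = E S^{p'}_𝔸 E` and `E X(p' s₀ p'⁻¹) E = 0` then `ψ_S(s₀) = 1`
(`tr(E S' E · X) = tr(S' · E X E) = 0`). [cite: Shimura1997, §18.1] [cite: MoeglinWaldspurger1995, II.1.7] -/
theorem unipDeltaChar_eq_one_of_corner {χ : Fin n → L} {p' : HA L e dV hdV dW hdW} (hp'P : IsSiegelDelta L e dV hdV dW hdW p') {S : Matrix (Fin n) (Fin n) L}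
    (hcorner : (Matrix.fromBlocks (1 : Matrix (Fin n) (Fin n) (AdeleRing (𝓞 L) L)) 0 (-1) 1 * blk L e dV hdV dW hdW p' * Matrix.fromBlocks 1 0 1 1).toBlocks₂₂ *
          S.map (algebraMap L (AdeleRing (𝓞 L) L)) * (deltaBlock L e dV hdV dW hdW p')⁻¹ =
        Matrix.diagonal (fun i => algebraMap L (AdeleRing (𝓞 L) L) (χ i)) *
          ((Matrix.fromBlocks (1 : Matrix (Fin n) (Fin n) (AdeleRing (𝓞 L) L)) 0 (-1) 1 * blk L e dV hdV dW hdW p' * Matrix.fromBlocks 1 0 1 1).toBlocks₂₂ *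
            S.map (algebraMap L (AdeleRing (𝓞 L) L)) * (deltaBlock L e dV hdV dW hdW p')⁻¹) *
          Matrix.diagonal (fun i => algebraMap L (AdeleRing (𝓞 L) L) (χ i)))
    {s₀ : HA L e dV hdV dW hdW} (hs₀ : s₀ ∈ unipDelta L e dV hdV dW hdW)
    (hE : Matrix.diagonal (fun i => algebraMap L (AdeleRing (𝓞 L) L) (χ i)) * (blk L e dV hdV dW hdW (p' * s₀ * p'⁻¹)).toBlocks₁₂ *
      Matrix.diagonal (fun i => algebraMap L (AdeleRing (𝓞 L) L) (χ i)) = 0) :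
    unipDeltaChar L e dV hdV dW hdW S s₀ = 1 := by
  have hu : p' * s₀ * p'⁻¹ ∈ unipDelta L e dV hdV dW hdW := by
    have h := conj_mem_unipDelta L e dV hdV dW hdW (isSiegelDelta_inv L e dV hdV dW hdW hp'P) hs₀
    rwa [inv_inv] at h
  have hs : s₀ = p'⁻¹ * (p' * s₀ * p'⁻¹) * p' := by group
  rw [hs, unipDeltaChar_conj_apply hp'P S hu, hcorner, Matrix.mul_assoc, Matrix.mul_assoc, Matrix.trace_mul_comm, Matrix.mul_assoc,
    hE, Matrix.mul_zero, Matrix.trace_zero, AddChar.map_zero_eq_one]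

/-! ## §2 Off the corner the orbit dies -/

/-- **KILLING DATUM OFF THE CORNER**: for `γ₀ = w_χ p'` (`p' ∈ P_Δ(L⁺)`) and a `T_L`-skew `S` whose conjugated index is NOT corner-supported
(`S^{p'}_𝔸 ≠ E S^{p'}_𝔸 E`), some `s₀ ∈ N_Δ(𝔸)` has `γ₀ s₀ γ₀⁻¹ ∈ P_Δ(𝔸)`, trivial inducing character there and `ψ_S(s₀) ≠ 1` — ★ Φ2 file 5
`map_eq_corner_of_forall_unipDeltaChar_eq_one` on `S^{p'} = D₀ S A₀⁻¹` (★ file 6), `s₀ = p'⁻¹ u p'`, ★ file 4 for the character.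
[cite: MoeglinWaldspurger1995, II.1.7] [cite: Shimura1997, §18.3] [cite: KudlaRallis1994, §2] -/
theorem exists_orbit_stabilizer_datum_of_ne_corner (hdV0 : ∀ i, dV i ≠ 0) (hdW0 : ∀ i, dW i ≠ 0) (χH : HeckeCharacter L) (s : ℂ)
    {g : UnitaryGroup.rationalPair (Fp L) L (IsCMField.complexConj L) N M (Matrix.diagonal dV) (Matrix.diagonal dW)} {χ : Fin n → L}
    (hχ : ∀ k, χ k = 0 ∨ χ k = 1) (hg : ((g : GL (Fin N × Fin M) L) : Matrix (Fin N × Fin M) (Fin N × Fin M) L) = Matrix.diagonal (fun k => 1 - 2 * χ (e k)))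
    (hgg : g * g = 1) {p' : HA L e dV hdV dW hdW} (hp'r : p' ∈ ratH L e dV hdV dW hdW) (hp'P : IsSiegelDelta L e dV hdV dW hdW p')
    {S : Matrix (Fin n) (Fin n) L}
    (hS : S ∈ skewMatrices ((IsCMField.complexConj L : L ≃ₐ[Fp L] L) : L →+* L) ((gramR L e dV hdV dW hdW).map (algebraMap (Fp L) L)))
    (hne : (Matrix.fromBlocks (1 : Matrix (Fin n) (Fin n) (AdeleRing (𝓞 L) L)) 0 (-1) 1 * blk L e dV hdV dW hdW p' * Matrix.fromBlocks 1 0 1 1).toBlocks₂₂ *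
          S.map (algebraMap L (AdeleRing (𝓞 L) L)) * (deltaBlock L e dV hdV dW hdW p')⁻¹ ≠
        Matrix.diagonal (fun i => algebraMap L (AdeleRing (𝓞 L) L) (χ i)) *
          ((Matrix.fromBlocks (1 : Matrix (Fin n) (Fin n) (AdeleRing (𝓞 L) L)) 0 (-1) 1 * blk L e dV hdV dW hdW p' * Matrix.fromBlocks 1 0 1 1).toBlocks₂₂ *
            S.map (algebraMap L (AdeleRing (𝓞 L) L)) * (deltaBlock L e dV hdV dW hdW p')⁻¹) *
          Matrix.diagonal (fun i => algebraMap L (AdeleRing (𝓞 L) L) (χ i))) :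
    ∃ s₀ : HA L e dV hdV dW hdW, s₀ ∈ unipDelta L e dV hdV dW hdW ∧
      IsSiegelDelta L e dV hdV dW hdW (iotaGG L e dV hdV dW hdW
          (1, UnitaryGroup.rationalPairToAdelic (Fp L) L (IsCMField.complexConj L) N M (Matrix.diagonal dV) (Matrix.diagonal dW) g) * p' * s₀ *
        (iotaGG L e dV hdV dW hdW (1, UnitaryGroup.rationalPairToAdelic (Fp L) L (IsCMField.complexConj L) N M (Matrix.diagonal dV) (Matrix.diagonal dW) g) * p')⁻¹) ∧
      siegelDeltaCharacter L e dV hdV dW hdW χH s (iotaGG L e dV hdV dW hdW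
          (1, UnitaryGroup.rationalPairToAdelic (Fp L) L (IsCMField.complexConj L) N M (Matrix.diagonal dV) (Matrix.diagonal dW) g) * p' * s₀ *
        (iotaGG L e dV hdV dW hdW (1, UnitaryGroup.rationalPairToAdelic (Fp L) L (IsCMField.complexConj L) N M (Matrix.diagonal dV) (Matrix.diagonal dW) g) * p')⁻¹) = 1 ∧
      unipDeltaChar L e dV hdV dW hdW S s₀ ≠ 1 := by
  obtain ⟨A₀, D₀, hA₀, ha, hd, hrel⟩ := exists_rat_levi_blocks L e dV hdV dW hdW hdV0 hdW0 hp'P hp'r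
  have hS' := conj_index_mem_skewMatrices L e dV hdV dW hdW hdV0 hdW0 hA₀ hrel hS
  have hdpat := pattern_map L hχ
  -- `S^{p'}_𝔸 = (D₀ S A₀⁻¹) ⊗ 1`
  have hmap : (D₀ * S * A₀⁻¹).map (algebraMap L (AdeleRing (𝓞 L) L)) =
      (Matrix.fromBlocks (1 : Matrix (Fin n) (Fin n) (AdeleRing (𝓞 L) L)) 0 (-1) 1 * blk L e dV hdV dW hdW p' * Matrix.fromBlocks 1 0 1 1).toBlocks₂₂ *
        S.map (algebraMap L (AdeleRing (𝓞 L) L)) * (deltaBlock L e dV hdV dW hdW p')⁻¹ := by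
    rw [Matrix.map_mul, Matrix.map_mul, map_nonsing_inv_of_isUnit _ hA₀, ← ha, ← hd]
  -- contrapositive of ★ file 5: some corner element sees `S^{p'}`
  have hex : ∃ u : HA L e dV hdV dW hdW, u ∈ unipDelta L e dV hdV dW hdW ∧
      Matrix.diagonal (fun i => algebraMap L (AdeleRing (𝓞 L) L) (χ i)) * (blk L e dV hdV dW hdW u).toBlocks₁₂ *
        Matrix.diagonal (fun i => algebraMap L (AdeleRing (𝓞 L) L) (χ i)) = 0 ∧ unipDeltaChar L e dV hdV dW hdW (D₀ * S * A₀⁻¹) u ≠ 1 := by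
    by_contra hall
    simp only [not_exists, not_and, not_not] at hall
    exact hne (by rw [← hmap]; exact map_eq_corner_of_forall_unipDeltaChar_eq_one L e dV hdV dW hdW hdV0 hdW0 hdpat hS' hall)
  obtain ⟨u, huN, hcorner, hne1⟩ := hex
  refine ⟨p'⁻¹ * u * p', conj_mem_unipDelta L e dV hdV dW hdW hp'P huN, ?_⟩
  have hconj : iotaGG L e dV hdV dW hdW
          (1, UnitaryGroup.rationalPairToAdelic (Fp L) L (IsCMField.complexConj L) N M (Matrix.diagonal dV) (Matrix.diagonal dW) g) * p' * (p'⁻¹ * u * p') *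
        (iotaGG L e dV hdV dW hdW (1, UnitaryGroup.rationalPairToAdelic (Fp L) L (IsCMField.complexConj L) N M (Matrix.diagonal dV) (Matrix.diagonal dW) g) * p')⁻¹ =
      iotaGG L e dV hdV dW hdW (1, UnitaryGroup.rationalPairToAdelic (Fp L) L (IsCMField.complexConj L) N M (Matrix.diagonal dV) (Matrix.diagonal dW) g) * u *
        (iotaGG L e dV hdV dW hdW (1, UnitaryGroup.rationalPairToAdelic (Fp L) L (IsCMField.complexConj L) N M (Matrix.diagonal dV) (Matrix.diagonal dW) g))⁻¹ := by
    rw [mul_inv_rev]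
    simp only [mul_assoc, mul_inv_cancel_left]
  have hgg' : UnitaryGroup.rationalPairToAdelic (Fp L) L (IsCMField.complexConj L) N M (Matrix.diagonal dV) (Matrix.diagonal dW) g *
      UnitaryGroup.rationalPairToAdelic (Fp L) L (IsCMField.complexConj L) N M (Matrix.diagonal dV) (Matrix.diagonal dW) g = 1 := by
    rw [← map_mul, hgg, map_one]
  have hX : (1 - Matrix.reindex e e (((UnitaryGroup.rationalPairToAdelic (Fp L) L (IsCMField.complexConj L) N M (Matrix.diagonal dV) (Matrix.diagonal dW) g :
        UnitaryGroup.adelicPair (Fp L) L (IsCMField.complexConj L) N M (Matrix.diagonal dV) (Matrix.diagonal dW)) :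
        GL (Fin N × Fin M) (AdeleRing (𝓞 L) L)) : Matrix (Fin N × Fin M) (Fin N × Fin M) (AdeleRing (𝓞 L) L))) * (blk L e dV hdV dW hdW u).toBlocks₁₂ *
      (1 - Matrix.reindex e e (((UnitaryGroup.rationalPairToAdelic (Fp L) L (IsCMField.complexConj L) N M (Matrix.diagonal dV) (Matrix.diagonal dW) g :
        UnitaryGroup.adelicPair (Fp L) L (IsCMField.complexConj L) N M (Matrix.diagonal dV) (Matrix.diagonal dW)) :
        GL (Fin N × Fin M) (AdeleRing (𝓞 L) L)) : Matrix (Fin N × Fin M) (Fin N × Fin M) (AdeleRing (𝓞 L) L))) = 0 := by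
    rw [one_sub_reindex_signInvolution L e dV dW hg]
    simp only [Matrix.smul_mul, Matrix.mul_smul, hcorner, smul_zero]
  obtain ⟨hP, hχ1⟩ := reflection_stabilizer_data L e dV hdV dW hdW χH s hgg' huN hX
  rw [hconj]
  exact ⟨hP, hχ1, by rwa [unipDeltaChar_conj_eq L e dV hdV dW hdW hp'P hA₀ ha hd S huN]⟩

section Orbit

variable [MeasurableSpace (unipDelta L e dV hdV dW hdW)] [BorelSpace (unipDelta L e dV hdV dW hdW)]

/-- **THE MIDDLE ORBIT `O(w_χ p')` DIES OFF THE CORNER**: for ANY `T_L`-skew index `S` whose conjugated index `S^{p'}_𝔸` is not corner-supported, the sum of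
the coefficient integrals over the orbit vanishes (★ file 7 `tsum_orbit_eq_zero` with the datum of §2).  For `det S ≠ 0` and `χ ≢ 1` this is ★ file 7.
[cite: KudlaRallis1994, §2] [cite: Tan1999, §3] [cite: Shimura1997, §18.3] [cite: MoeglinWaldspurger1995, II.1.7] -/
theorem tsum_middle_orbit_eq_zero_of_ne_corner (hdV0 : ∀ i, dV i ≠ 0) (hdW0 : ∀ i, dW i ≠ 0) (νN : Measure (unipDelta L e dV hdV dW hdW)) [νN.IsMulLeftInvariant]
    {β : unipDelta L e dV hdV dW hdW → ℝ≥0∞} (hβ : IsCoveringWeight (unipDeltaRat L e dV hdV dW hdW) β)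
    {χH : HeckeCharacter L} {s : ℂ} {f : HA L e dV hdV dW hdW → ℂ} (hf : IsSiegelDeltaSection L e dV hdV dW hdW χH s f) (hfc : Continuous f)
    {g : UnitaryGroup.rationalPair (Fp L) L (IsCMField.complexConj L) N M (Matrix.diagonal dV) (Matrix.diagonal dW)} {χ : Fin n → L}
    (hχ : ∀ k, χ k = 0 ∨ χ k = 1) (hg : ((g : GL (Fin N × Fin M) L) : Matrix (Fin N × Fin M) (Fin N × Fin M) L) = Matrix.diagonal (fun k => 1 - 2 * χ (e k)))
    (hgg : g * g = 1) {p' : HA L e dV hdV dW hdW} (hp'r : p' ∈ ratH L e dV hdV dW hdW) (hp'P : IsSiegelDelta L e dV hdV dW hdW p')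
    (hγ₀ : iotaGG L e dV hdV dW hdW (1, UnitaryGroup.rationalPairToAdelic (Fp L) L (IsCMField.complexConj L) N M (Matrix.diagonal dV) (Matrix.diagonal dW) g) * p' ∈
      ratH L e dV hdV dW hdW)
    (h : HA L e dV hdV dW hdW) {S : Matrix (Fin n) (Fin n) L}
    (hS : S ∈ skewMatrices ((IsCMField.complexConj L : L ≃ₐ[Fp L] L) : L →+* L) ((gramR L e dV hdV dW hdW).map (algebraMap (Fp L) L)))
    (hne : (Matrix.fromBlocks (1 : Matrix (Fin n) (Fin n) (AdeleRing (𝓞 L) L)) 0 (-1) 1 * blk L e dV hdV dW hdW p' * Matrix.fromBlocks 1 0 1 1).toBlocks₂₂ *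
          S.map (algebraMap L (AdeleRing (𝓞 L) L)) * (deltaBlock L e dV hdV dW hdW p')⁻¹ ≠
        Matrix.diagonal (fun i => algebraMap L (AdeleRing (𝓞 L) L) (χ i)) *
          ((Matrix.fromBlocks (1 : Matrix (Fin n) (Fin n) (AdeleRing (𝓞 L) L)) 0 (-1) 1 * blk L e dV hdV dW hdW p' * Matrix.fromBlocks 1 0 1 1).toBlocks₂₂ *
            S.map (algebraMap L (AdeleRing (𝓞 L) L)) * (deltaBlock L e dV hdV dW hdW p')⁻¹) *
          Matrix.diagonal (fun i => algebraMap L (AdeleRing (𝓞 L) L) (χ i)))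
    (hO : ∫⁻ u, (∑' q : ↥(Set.range (fun ν : unipDeltaRat L e dV hdV dW hdW =>
        (Quotient.mk (MulAction.orbitRel (siegelDeltaRat L e dV hdV dW hdW) (ratH L e dV hdV dW hdW))
          ((⟨_, hγ₀⟩ : ratH L e dV hdV dW hdW) * ⟨((ν : unipDelta L e dV hdV dW hdW) : HA L e dV hdV dW hdW), coe_mem_ratH ν⟩)))),
        ‖f (((Quotient.out q.1 : ratH L e dV hdV dW hdW) : HA L e dV hdV dW hdW) * ((u : HA L e dV hdV dW hdW) * h))‖ₑ) * β u ∂νN ≠ ∞) :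
    ∑' q : ↥(Set.range (fun ν : unipDeltaRat L e dV hdV dW hdW =>
        (Quotient.mk (MulAction.orbitRel (siegelDeltaRat L e dV hdV dW hdW) (ratH L e dV hdV dW hdW))
          ((⟨_, hγ₀⟩ : ratH L e dV hdV dW hdW) * ⟨((ν : unipDelta L e dV hdV dW hdW) : HA L e dV hdV dW hdW), coe_mem_ratH ν⟩)))),
      ∫ u, (β u).toReal • (conj (unipDeltaChar L e dV hdV dW hdW S (u : HA L e dV hdV dW hdW) : ℂ) *
        f (((Quotient.out q.1 : ratH L e dV hdV dW hdW) : HA L e dV hdV dW hdW) * ((u : HA L e dV hdV dW hdW) * h))) ∂νN = 0 := by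
  obtain ⟨s₀, hs₀N, hP, hχ1, hne1⟩ := exists_orbit_stabilizer_datum_of_ne_corner hdV0 hdW0 χH s hχ hg hgg hp'r hp'P hS hne
  exact tsum_orbit_eq_zero νN hβ hf hfc ⟨_, hγ₀⟩ h S hO (s₀ := ⟨s₀, hs₀N⟩) hP hχ1 hne1

end Orbit

/-! ## §3 Sharpness: on the corner no killing datum exists -/

/-- **SURVIVOR CRITERION (sharp)**: for `γ₀ = w_χ p'` and a `T_L`-skew `S`, «every `s₀ ∈ N_Δ(𝔸)` stabilising `[γ₀]` has `ψ_S(s₀) = 1`» ⟺ «`S^{p'}_𝔸` is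
corner-supported».  (⇐ §1; ⇒ §2.)  So in the orbit decomposition of the `S`-th Fourier coefficient of the Siegel Eisenstein series exactly the orbits `[w_χ p']`
with `S^{p'}_𝔸 = E S^{p'}_𝔸 E` can survive — none when `det S ≠ 0` (★ `integral_rest_eq_zero`), the rank-`r` singular coefficients otherwise.
[cite: KudlaRallis1994, §2] [cite: Shimura1997, §18.3] [cite: MoeglinWaldspurger1995, II.1.7] -/
theorem forall_stabilizer_unipDeltaChar_eq_one_iff_corner (hdV0 : ∀ i, dV i ≠ 0) (hdW0 : ∀ i, dW i ≠ 0)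
    {g : UnitaryGroup.rationalPair (Fp L) L (IsCMField.complexConj L) N M (Matrix.diagonal dV) (Matrix.diagonal dW)} {χ : Fin n → L}
    (hχ : ∀ k, χ k = 0 ∨ χ k = 1) (hg : ((g : GL (Fin N × Fin M) L) : Matrix (Fin N × Fin M) (Fin N × Fin M) L) = Matrix.diagonal (fun k => 1 - 2 * χ (e k)))
    (hgg : g * g = 1) {p' : HA L e dV hdV dW hdW} (hp'r : p' ∈ ratH L e dV hdV dW hdW) (hp'P : IsSiegelDelta L e dV hdV dW hdW p')
    {S : Matrix (Fin n) (Fin n) L}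
    (hS : S ∈ skewMatrices ((IsCMField.complexConj L : L ≃ₐ[Fp L] L) : L →+* L) ((gramR L e dV hdV dW hdW).map (algebraMap (Fp L) L))) :
    (∀ s₀ : HA L e dV hdV dW hdW, s₀ ∈ unipDelta L e dV hdV dW hdW →
      IsSiegelDelta L e dV hdV dW hdW (iotaGG L e dV hdV dW hdW
          (1, UnitaryGroup.rationalPairToAdelic (Fp L) L (IsCMField.complexConj L) N M (Matrix.diagonal dV) (Matrix.diagonal dW) g) * p' * s₀ *
        (iotaGG L e dV hdV dW hdW (1, UnitaryGroup.rationalPairToAdelic (Fp L) L (IsCMField.complexConj L) N M (Matrix.diagonal dV) (Matrix.diagonal dW) g) * p')⁻¹) →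
      unipDeltaChar L e dV hdV dW hdW S s₀ = 1) ↔
    (Matrix.fromBlocks (1 : Matrix (Fin n) (Fin n) (AdeleRing (𝓞 L) L)) 0 (-1) 1 * blk L e dV hdV dW hdW p' * Matrix.fromBlocks 1 0 1 1).toBlocks₂₂ *
          S.map (algebraMap L (AdeleRing (𝓞 L) L)) * (deltaBlock L e dV hdV dW hdW p')⁻¹ =
        Matrix.diagonal (fun i => algebraMap L (AdeleRing (𝓞 L) L) (χ i)) *
          ((Matrix.fromBlocks (1 : Matrix (Fin n) (Fin n) (AdeleRing (𝓞 L) L)) 0 (-1) 1 * blk L e dV hdV dW hdW p' * Matrix.fromBlocks 1 0 1 1).toBlocks₂₂ *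
            S.map (algebraMap L (AdeleRing (𝓞 L) L)) * (deltaBlock L e dV hdV dW hdW p')⁻¹) *
          Matrix.diagonal (fun i => algebraMap L (AdeleRing (𝓞 L) L) (χ i)) := by
  constructor
  · intro hall
    by_contra hne
    obtain ⟨s₀, hs₀N, hP, -, hne1⟩ := exists_orbit_stabilizer_datum_of_ne_corner hdV0 hdW0 1 0 hχ hg hgg hp'r hp'P hS hne
    exact hne1 (hall s₀ hs₀N hP)
  · intro hcorner s₀ hs₀N hP
    exact unipDeltaChar_eq_one_of_corner hp'P hcorner hs₀N ((stabilizer_iff_corner hg hgg hp'P hs₀N).1 hP)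

end Summit.HodgeConjecture.HodgeConjecture.Cruxes.HLiu418.K2LiuSiegelEisensteinCoeffOrbitCriterion

end
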